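import Summits.BirchSwinnertonDyer.Rank1Residual.Additive.SignedTwistPlusDualTransport
import Summits.BirchSwinnertonDyer.Rank1Residual.Additive.SignedTwistOddBranchReadings
import Summits.BirchSwinnertonDyer.Rank1Residual.Additive.QuadraticBranchEvenControlBSD
import HarnessLib

/-!
# The EVEN readings (R1⁺) / (R2⁺) DISCHARGED from the VERBATIM `η`-component shapes by the PLUS
# signed-`η` twist dictionary (cell `bsd-potss`, seat `bsd-potss-ctrl` g2; T-e2-R1⁺ piece (ii),
# TARGET.md v6 §0.12 (e) / R62; the sign-`+` twin of x1b's P5-5b `SignedTwistOddBranchReadings`)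

HONEST FRAMING (cell `bsd-potss`, run/shared/lean/pub/bsd-potss/; FULL-BSD rank ≤ 1 programme,
tranche 1b): TOOL THEOREMS ONLY — no definition, no named Literature fact, no Summits-side fact
`def … : Prop`, no `sorry`, axioms standard. The two VERBATIM SHAPES are HYPOTHESES, exactly as in
x1b's P5-5b (texts `h74`/`hKO` with sign `+` and the PLUS branch function): `hMC` = Kobayashi's EVEN
main conjecture AT `η` ON THE `η`-COMPONENT OBJECT `X⁺(V/K_∞)^η` (cc-typer-6's
`EtaSignedSelmerDualData V κ ℚ(μ_p) ℚ_[p] η γ 1`, §4 p. 8 verbatim "`Char(X⁺(E/K_∞)^η) = (L_p⁺(E, η, X))`")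
read ON TOP OF the tree's typed (C1_η) `QuadraticBranchPlusMainConjectureAt V p` (its `ℚ(√p*)`-subtower
form; reading flag `Kob03-MC-eta-quadratic-subtower` = the prime-to-`p` descent
`X⁺(V/F_∞) ≅ X⁺(V/ℚ_∞) ⊕ X⁺(V/K_∞)^η` + Thm. 2.2 + `Λ` a domain, NOT formalised here — it is the
remaining piece (i) of T-e2-R1⁺, a base-change comparison of Kobayashi's signed Selmer groups along
`ℚ(√p*)/ℚ`); `hKO` = Kitajima–Otsuki Main Thm. 1.3, sign `+`, `η`-part (flag `KO18-eta-summand`).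
NOTHING about the printed theorems / conjecture is asserted; (C1_η) stays a typed `@[conjecture]`;
nothing is booked; no label / mark / count moves; `BSD(W, p)` is not claimed.

## What
* **`evenBranchPlusCharIdealOfPlusMCAt_of_plusMCEta`** — (R1⁺) `EvenBranchPlusCharIdealOfPlusMCAt W p`
  ⟸ `hMC`. Proof = x1b's P5-5b: `K₀ = ℚ(μ_p)`, `θ² = p*` (Gauss), `η` by [SIGN], (D0) / `κ(G₀) = ℤ_p` /
  `p ∤ [K₀:ℚ]` from the tree, move `γ` to `γ' ∈ Gal(ℚ̄/K₀)` with `κ γ' = κ γ` (the cyclotomic variable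
  survives), and read the consumer's datum `D` of `X⁺_W(ℚ_∞)` as an `η`-signed plus datum of `V` with
  the SAME module ((D5⁺) `exists_etaSignedSelmerDualData_one`).
* **`evenBranchPlusNoFiniteSubmoduleAt_of_kitajimaOtsuki13PlusEta`** — (R2⁺)
  `EvenBranchPlusNoFiniteSubmoduleAt W p` ⟸ `hKO`, same proof.
* §2 `missingLowerBoundAt_rankZero_of_plusMCEta`, `bsdp_rankZero_of_plusMCEta_of_katoTam` — file 6's
  `r_an = 0` consumers with `hR1` REPLACED by `hMC`: the Gss2 rank-0 lower half / `BSD(W, p)` from ONE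
  verbatim-shape hypothesis on Kobayashi's own object + (C1_η) + named facts (binder lists displayed).

References: [Kobayashi2003] §4 p. 8 (even MC at η; `M^η = ε_η M`), Def. 2.1 and Thm. 2.2 (p. 5),
§3 p. 5; [KitajimaOtsuki2018] Main Thm. 1.3 with Def. 2.1; [GreenbergLNM1716] §3 (descent; reading).
-/

noncomputable section

open scoped Classical

open CongruenceSubgroup WeierstrassCurve Field

namespace Summit.BirchSwinnertonDyer.Rank1Residual.Additive.SignedTwist

open Literature.NumberTheory.EllipticCurves Literature.NumberTheory.EllipticCurves.ModularForms
  Literature.NumberTheory.GaloisRepresentations Literature.NumberTheory.EllipticCurves.Kobayashi2003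
  Summit.BirchSwinnertonDyer.Rank1Residual.AdditivePotMult ZpExtension

variable (W : WeierstrassCurve ℚ) [W.IsElliptic] [W.IsGloballyMinimal] (p : ℕ) [Fact p.Prime]

/-- **(R1⁺) from the VERBATIM shape of Kobayashi's EVEN main conjecture at `η` on cc-typer-6's
`η`-component object, read on top of the typed (C1_η), by the PLUS dictionary.** Hypothesis `hMC` is
x1b's `h74` frame with sign `+`, the PLUS branch function (`IsQuadraticBranchPlusLFunction`) and the
ideal EQUALITY as conclusion (flags `Kob03-MC-eta-quadratic-subtower`: (C1_η) in its `ℚ(√p*)`-form ⟹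
the `η`-component form — the descent reading, NOT formalised). Proof: `K₀ = ℚ(μ_p)`, `θ² = p*`, move
`γ` to `γ' ∈ Gal(ℚ̄/K₀)` with `κ γ' = κ γ`, and read `D` through (D5⁺) (same module, same
characteristic ideal). NOTHING about the conjecture is asserted here.
[cite: Kobayashi2003, §4 p. 8 (even main conjecture at η), Thm. 2.2 (p. 5), §3 p. 5] -/
theorem evenBranchPlusCharIdealOfPlusMCAt_of_plusMCEta
    (hMC : ∀ (K₀ : Type) [Field K₀] [NumberField K₀] [IsCyclotomicExtension {p} ℚ K₀]
        [(galRange (K := ℚ) K₀).Normal] (ηq : absoluteGaloisGroup ℚ →* ℤˣ),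
        (∀ σ ∈ galRange (K := ℚ) K₀, ηq σ = 1) → ηq ≠ 1 →
      ∀ (V : WeierstrassCurve ℚ) [V.IsElliptic] [V.IsGloballyMinimal] {N : ℕ} [NeZero N]
        {f : CuspForm (Gamma0 N) 2},
        p ≠ 2 → V.HasGoodReductionAtPrime p → V.frobeniusTrace p = 0 →
        QuadraticBranchPlusMainConjectureAt V p → IsNewformOf V f →
      ∀ (ϖ : ℚ), (if Even (p / 2) then (ϖ : ℝ) * V.realPeriodRat = plusPeriod f
          else (ϖ : ℝ) * V.imaginaryPeriodRat = minusPeriod f) →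
      ∀ (Lη : IwasawaAlgebra p), IsQuadraticBranchPlusLFunction f p ϖ Lη →
      ∀ (κ : ZpExtension ℚ p) (γ : absoluteGaloisGroup ℚ),
        κ.IsCyclotomic → κ.IsTopGenerator γ → γ ∈ galRange (K := ℚ) K₀ →
        IsCyclotomicVariable p γ →
      ∀ (D : EtaSignedSelmerDualData V κ K₀ ℚ_[p] ηq γ 1),
        Module.Finite (IwasawaAlgebra p) D.X ∧ Module.IsTorsion (IwasawaAlgebra p) D.X ∧
          D.charIdeal = Ideal.span {Lη}) :
    EvenBranchPlusCharIdealOfPlusMCAt W p := by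
  intro V _ _ C N _ f hp2 hCV hgood hap hplus hf ϖ hϖ Lη hL κ γ hκ hγ hγc D
  haveI : NeZero p := ⟨(Fact.out : p.Prime).ne_zero⟩
  haveI : IsCyclotomicExtension {p} ℚ (CyclotomicField p ℚ) :=
    CyclotomicField.isCyclotomicExtension p ℚ
  haveI : (galRange (K := ℚ) (CyclotomicField p ℚ)).Normal := normal_galRange_cyclotomic p _
  obtain ⟨θ, η, hθ, hc, hη, hηK, hη1⟩ := exists_theta_eta_cyclotomicField p hp2
  have hD := localTowerHyp_padic p κ (CyclotomicField p ℚ) hκ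
  have hκ₀ := kappa_surjOn_galRange_cyclotomic κ (CyclotomicField p ℚ)
  have hcop := coprime_index_galRange_cyclotomic p (CyclotomicField p ℚ)
  obtain ⟨γ', hγ'K, hγ'κ⟩ := hκ₀ (κ γ)
  have hγγ' : γ⁻¹ * γ' ∈ κ.kerSubgroup := by
    rw [mem_kerSubgroup, map_mul, map_inv, hγ'κ, inv_mul_cancel]
  have hγ' : κ.IsTopGenerator γ' := by rw [ZpExtension.IsTopGenerator, hγ'κ]; exact hγ
  have hγ'c : IsCyclotomicVariable p γ' := isCyclotomicVariable_of_inv_mul_mem_ker hκ hγγ' hγc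
  obtain ⟨D', hfin, htor, hchar, -⟩ := exists_etaSignedSelmerDualData_one W (CyclotomicField p ℚ)
    hθ hc p κ hCV η hη ℚ_[p] hD hκ₀ hcop hγ'K hγγ' D
  obtain ⟨h1, h2, h3⟩ := hMC (CyclotomicField p ℚ) η hηK hη1 V hp2 hgood hap hplus hf ϖ hϖ Lη hL κ
    γ' hκ hγ' hγ'K hγ'c D'
  exact ⟨hfin.mp h1, htor.mp h2, hchar ▸ h3⟩

/-- **(R2⁺) from the VERBATIM shape of Kitajima–Otsuki Main Thm. 1.3 (sign `+`, `η`-part) on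
cc-typer-6's object, by the PLUS dictionary.** Hypothesis `hKO` is x1b's `hKO` text with sign `+`
(docstring flag `KO18-eta-summand`: the print is for `X⁺(F_∞)` whole, an `η`-part is a direct
summand). Same proof as (R1⁺), the finite submodule living in the SAME module. NOTHING about the
printed theorem is asserted here.
[cite: KitajimaOtsuki2018, Main Thm. 1.3 (= Thm. 4.8) with Def. 2.1] [cite: Kobayashi2003, §4 p. 8] -/
theorem evenBranchPlusNoFiniteSubmoduleAt_of_kitajimaOtsuki13PlusEta
    (hKO : ∀ (K₀ : Type) [Field K₀] [NumberField K₀] [IsCyclotomicExtension {p} ℚ K₀]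
        [(galRange (K := ℚ) K₀).Normal] (ηq : absoluteGaloisGroup ℚ →* ℤˣ),
        (∀ σ ∈ galRange (K := ℚ) K₀, ηq σ = 1) →
      ∀ (V : WeierstrassCurve ℚ) [V.IsElliptic] [V.IsGloballyMinimal],
        p ≠ 2 → V.HasGoodReductionAtPrime p → V.frobeniusTrace p = 0 →
      ∀ (κ : ZpExtension ℚ p) (γ : absoluteGaloisGroup ℚ),
        κ.IsCyclotomic → κ.IsTopGenerator γ → γ ∈ galRange (K := ℚ) K₀ →
      ∀ (D : EtaSignedSelmerDualData V κ K₀ ℚ_[p] ηq γ 1),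
        Module.Finite (IwasawaAlgebra p) D.X → Module.IsTorsion (IwasawaAlgebra p) D.X →
        ∀ M : Submodule (IwasawaAlgebra p) D.X, Finite M → M = ⊥) :
    EvenBranchPlusNoFiniteSubmoduleAt W p := by
  intro V _ _ C hp2 hCV hgood hap κ γ hκ hγ D hDfin hDtor M hM
  haveI : NeZero p := ⟨(Fact.out : p.Prime).ne_zero⟩
  haveI : IsCyclotomicExtension {p} ℚ (CyclotomicField p ℚ) :=
    CyclotomicField.isCyclotomicExtension p ℚ
  haveI : (galRange (K := ℚ) (CyclotomicField p ℚ)).Normal := normal_galRange_cyclotomic p _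
  obtain ⟨θ, η, hθ, hc, hη, hηK, -⟩ := exists_theta_eta_cyclotomicField p hp2
  have hD := localTowerHyp_padic p κ (CyclotomicField p ℚ) hκ
  have hκ₀ := kappa_surjOn_galRange_cyclotomic κ (CyclotomicField p ℚ)
  have hcop := coprime_index_galRange_cyclotomic p (CyclotomicField p ℚ)
  obtain ⟨γ', hγ'K, hγ'κ⟩ := hκ₀ (κ γ)
  have hγγ' : γ⁻¹ * γ' ∈ κ.kerSubgroup := by
    rw [mem_kerSubgroup, map_mul, map_inv, hγ'κ, inv_mul_cancel]
  have hγ' : κ.IsTopGenerator γ' := by rw [ZpExtension.IsTopGenerator, hγ'κ]; exact hγ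
  obtain ⟨D', hfin, htor, -, hnf⟩ := exists_etaSignedSelmerDualData_one W (CyclotomicField p ℚ)
    hθ hc p κ hCV η hη ℚ_[p] hD hκ₀ hcop hγ'K hγγ' D
  exact hnf.mp (hKO (CyclotomicField p ℚ) η hηK V hp2 hgood hap κ γ' hκ hγ' hγ'K D' (hfin.mpr hDfin)
    (htor.mpr hDtor)) M hM

end Summit.BirchSwinnertonDyer.Rank1Residual.Additive.SignedTwist

/-! ## §2 The rank-`0` consumers with `hR1` replaced by the verbatim shape `hMC` -/

namespace Summit.BirchSwinnertonDyer.Rank1Residual.Additive.EvenControlZero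

open Literature.NumberTheory.EllipticCurves Literature.NumberTheory.EllipticCurves.ModularForms
  Literature.NumberTheory.GaloisRepresentations Literature.NumberTheory.EllipticCurves.Kobayashi2003
  Literature.NumberTheory.EllipticCurves.Rank1Residual Literature.NumberTheory.EllipticCurves.Rank1Residual.Typed
  Summit.BirchSwinnertonDyer.Rank1Residual.AdditivePotMult ZpExtension

variable (W : WeierstrassCurve ℚ) [W.IsElliptic] [W.IsGloballyMinimal] (p : ℕ) [Fact p.Prime]

/-- **The LOWER half `ord_p #Ш(W)_an ≤ ord_p #Ш(W)` at Gss2 in analytic rank `0` from the VERBATIM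
shape `hMC` (Kobayashi's even MC at `η` on `X⁺(V/K_∞)^η`, read on top of (C1_η)) + (C1_η) + GZK +
modularity**, every odd `p`: file 6's `missingLowerBoundAt_rankZero_of_evenReading` with `hR1`
discharged by `evenBranchPlusCharIdealOfPlusMCAt_of_plusMCEta`. CONDITIONAL on the displayed inputs;
nothing booked. [cite: Kobayashi2003, §4 (p. 8), Thm. 9.3 with (9.33) (pp. 26–27), (3.6) (p. 7)]
[cite: Miller2011LMS, Def. 1.1] -/
theorem missingLowerBoundAt_rankZero_of_plusMCEta
    (hGZK : rank_eq_analyticRank_of_analyticRank_le_one) (hmod : hasEntireLFunction_rat)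
    (hMC : ∀ (K₀ : Type) [Field K₀] [NumberField K₀] [IsCyclotomicExtension {p} ℚ K₀]
        [(galRange (K := ℚ) K₀).Normal] (ηq : absoluteGaloisGroup ℚ →* ℤˣ),
        (∀ σ ∈ galRange (K := ℚ) K₀, ηq σ = 1) → ηq ≠ 1 →
      ∀ (V : WeierstrassCurve ℚ) [V.IsElliptic] [V.IsGloballyMinimal] {N : ℕ} [NeZero N]
        {f : CuspForm (Gamma0 N) 2},
        p ≠ 2 → V.HasGoodReductionAtPrime p → V.frobeniusTrace p = 0 →
        QuadraticBranchPlusMainConjectureAt V p → IsNewformOf V f →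
      ∀ (ϖ : ℚ), (if Even (p / 2) then (ϖ : ℝ) * V.realPeriodRat = plusPeriod f
          else (ϖ : ℝ) * V.imaginaryPeriodRat = minusPeriod f) →
      ∀ (Lη : IwasawaAlgebra p), IsQuadraticBranchPlusLFunction f p ϖ Lη →
      ∀ (κ : ZpExtension ℚ p) (γ : absoluteGaloisGroup ℚ),
        κ.IsCyclotomic → κ.IsTopGenerator γ → γ ∈ galRange (K := ℚ) K₀ →
        IsCyclotomicVariable p γ →
      ∀ (D : EtaSignedSelmerDualData V κ K₀ ℚ_[p] ηq γ 1),
        Module.Finite (IwasawaAlgebra p) D.X ∧ Module.IsTorsion (IwasawaAlgebra p) D.X ∧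
          D.charIdeal = Ideal.span {Lη})
    (V : WeierstrassCurve ℚ) [V.IsElliptic] [V.IsGloballyMinimal] (C : VariableChange ℚ)
    {N : ℕ} [NeZero N] {f : CuspForm (Gamma0 N) 2}
    (hp2 : p ≠ 2) (hCV : C • W.quadraticTwist ((-1) ^ (p / 2) * p) = V)
    (hgood : V.HasGoodReductionAtPrime p) (hap : V.frobeniusTrace p = 0)
    (h1 : QuadraticBranchPlusMainConjectureAt V p) (hf : IsNewformOf V f) {ϖ : ℚ}
    (hϖ : if Even (p / 2) then (ϖ : ℝ) * V.realPeriodRat = plusPeriod f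
      else (ϖ : ℝ) * V.imaginaryPeriodRat = minusPeriod f)
    {L : IwasawaAlgebra p} (hL : IsQuadraticBranchPlusLFunction f p ϖ L)
    (hLW : W.entireLFunction 1 ≠ 0) :
    MissingLowerBoundAt W p :=
  missingLowerBoundAt_rankZero_of_evenReading W p hGZK hmod
    (SignedTwist.evenBranchPlusCharIdealOfPlusMCAt_of_plusMCEta W p hMC) V C hp2 hCV hgood hap h1 hf
    hϖ hL hLW

/-- **`BSD(W, p)` at Gss2 in analytic rank `0` from the verbatim shape `hMC` + (C1_η) + Kato's
Tamagawa-exact upper half** (`ClassX4` rows with tower surjectivity; no Tamagawa / Manin side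
condition): file 6's `bsdp_rankZero_of_evenReading_of_katoTam` with `hR1` discharged. CONDITIONAL on
the displayed inputs; nothing booked. [cite: Kato2004Asterisque, Thm. 14.5 (3) (p. 236), Prop. 14.16 (2) (p. 244)]
[cite: Kobayashi2003, §4 (p. 8), Thm. 9.3 (p. 26), (3.6) (p. 7)] [cite: Miller2011LMS, §1 and Def. 1.1] -/
theorem bsdp_rankZero_of_plusMCEta_of_katoTam
    (hKatoT : Kato2004.rankZero_padicValNat_sha_add_padicValNat_tamagawa_le_of_additive_potGood_of_imageContainsSL2)
    (hGZK : rank_eq_analyticRank_of_analyticRank_le_one) (hmod : hasEntireLFunction_rat)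
    (hMC : ∀ (K₀ : Type) [Field K₀] [NumberField K₀] [IsCyclotomicExtension {p} ℚ K₀]
        [(galRange (K := ℚ) K₀).Normal] (ηq : absoluteGaloisGroup ℚ →* ℤˣ),
        (∀ σ ∈ galRange (K := ℚ) K₀, ηq σ = 1) → ηq ≠ 1 →
      ∀ (V : WeierstrassCurve ℚ) [V.IsElliptic] [V.IsGloballyMinimal] {N : ℕ} [NeZero N]
        {f : CuspForm (Gamma0 N) 2},
        p ≠ 2 → V.HasGoodReductionAtPrime p → V.frobeniusTrace p = 0 →
        QuadraticBranchPlusMainConjectureAt V p → IsNewformOf V f →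
      ∀ (ϖ : ℚ), (if Even (p / 2) then (ϖ : ℝ) * V.realPeriodRat = plusPeriod f
          else (ϖ : ℝ) * V.imaginaryPeriodRat = minusPeriod f) →
      ∀ (Lη : IwasawaAlgebra p), IsQuadraticBranchPlusLFunction f p ϖ Lη →
      ∀ (κ : ZpExtension ℚ p) (γ : absoluteGaloisGroup ℚ),
        κ.IsCyclotomic → κ.IsTopGenerator γ → γ ∈ galRange (K := ℚ) K₀ →
        IsCyclotomicVariable p γ →
      ∀ (D : EtaSignedSelmerDualData V κ K₀ ℚ_[p] ηq γ 1),
        Module.Finite (IwasawaAlgebra p) D.X ∧ Module.IsTorsion (IwasawaAlgebra p) D.X ∧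
          D.charIdeal = Ideal.span {Lη})
    (V : WeierstrassCurve ℚ) [V.IsElliptic] [V.IsGloballyMinimal] (C : VariableChange ℚ)
    {N : ℕ} [NeZero N] {f : CuspForm (Gamma0 N) 2}
    (hp2 : p ≠ 2) (hCV : C • W.quadraticTwist ((-1) ^ (p / 2) * p) = V)
    (hgood : V.HasGoodReductionAtPrime p) (hap : V.frobeniusTrace p = 0)
    (h1 : QuadraticBranchPlusMainConjectureAt V p) (hf : IsNewformOf V f) {ϖ : ℚ}
    (hϖ : if Even (p / 2) then (ϖ : ℝ) * V.realPeriodRat = plusPeriod f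
      else (ϖ : ℝ) * V.imaginaryPeriodRat = minusPeriod f)
    {L : IwasawaAlgebra p} (hL : IsQuadraticBranchPlusLFunction f p ϖ L)
    (hr : W.analyticRank = 0) (hX : ClassX4 W p)
    (hsurj : ∀ n : ℕ, W.HasSurjectiveModNGaloisRep (p ^ n : ℕ)) : BSDp W p :=
  bsdp_rankZero_of_evenReading_of_katoTam W p hKatoT hGZK hmod
    (SignedTwist.evenBranchPlusCharIdealOfPlusMCAt_of_plusMCEta W p hMC) V C hp2 hCV hgood hap h1 hf
    hϖ hL hr hX hsurj

end Summit.BirchSwinnertonDyer.Rank1Residual.Additive.EvenControlZero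

end
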